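import Summits.AtomisticToContinuum.HydrodynamicLimit.Theses.JParityClosure
import Summits.AtomisticToContinuum.HydrodynamicLimit.Theorems.JParityClosureAssemblySpeedJumpWindowOfEvenStat
import Summits.AtomisticToContinuum.HydrodynamicLimit.Theorems.InformationPercolationEngineChaosClosesEulerReadoutPathwise
import HarnessLib

/-!
# Momentum third at the instant `t` (crux `JParityClosure.ParityBandClosure`, stmt-AtomisticToContinuum-17608,
# line `entropy-floor-fixes-energy`, stub `stub_momentumAtInstant`) — helper: the pathwise step

WHAT. The deterministic and bookkeeping pieces of the stub `stub_momentumAtInstant` (the MOMENTUM third of the crux's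
conclusion at EVERY instant `t` from the time-averaged identification `MollifiedCloseTimeAveraged`, the route's crux
`EvenStressEnskog` and the cap `DensityCap`):

* `tendsto_momentum_of_isSmooth` — it suffices to test the empirical MOMENTUM field against smooth functions
  (the momentum component of `tendstoHydroFieldsAt_of_isSmooth`, re-proved alone: uniform approximation
  `exists_isSmooth_near`, `empiricalFields_sub_le`, energy tightness);
* `momentum_chain_speedJump` — along ONE good orbit, for a smooth test `b` read one Cartesian component at a time
  (`J_k = b • e_k`) and one instant `s₀ ≥ t`: `‖M_b(t) − ∫ b • m(t)‖ ≤ 3((s₀ − t)·L·2Ē + L·(ε/(N+1))·½𝒮(t, s₀]) +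
  ω_b(r)(1/2 + Ē) + L·e_m(s₀) + L·e_U`, `𝒮` the windowed normal-SPEED-JUMP functional of
  `JParityClosureMomentumModulus.abs_momentumObservable_flow_sub_le` (NOT the quadratic collision functional of
  `ChaosClosesEulerReadout.momentum_chain`), then the cone commutator of `KineticClosureBridge`, the `L¹(dx)` error
  at `s₀` and the Euler time continuity;
* `stub_momentumAtInstantPathwise` (the registered sub-goal) — on the complement of the bad events (energy level, time-averaged `L¹` error `≤ κ₁Δ`, windowed
  speed-jump statistic `≤ η_s`) the `b`-tested empirical momentum at `t` is within `5κ/8` of `∫ (bρ)(t) • u(t)`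
  (one good instant `exists_good_instant`, monotonicity of `𝒮` in the window, bookkeeping).

No named fact is invoked: everything is proved from tree lemmas.
-/

noncomputable section

namespace Summit.AtomisticToContinuum.HydrodynamicLimit.Theorems.ParityBandClosureMomentumAtInstant

open scoped BigOperators Topology Classical MeasureTheory ENNReal InnerProductSpace
open Filter Set MeasureTheory
open Literature.MathematicalPhysics.KineticTheory
open Literature.Analysis.FluidPDE
open Literature.Analysis.FunctionSpaces
open Summit.AtomisticToContinuum.HydrodynamicLimit.Theses
open Summit.AtomisticToContinuum.HydrodynamicLimit.Theorems.DensityCapNegative (cone)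
open Summit.AtomisticToContinuum.HydrodynamicLimit.Theorems.KineticClosureBridge
  (meanSpeed_le norm_empiricalMomentumField_sub_integral_smul_le continuous_mollMomentum norm_integral_smul_sub_le)
open Summit.AtomisticToContinuum.HydrodynamicLimit.Theorems.JParityClosureMomentumModulus
  (abs_momentumObservable_flow_sub_le collisionalTransferFunctional_mono_right collisionalTransferFunctional_nonneg)
open Summit.AtomisticToContinuum.HydrodynamicLimit.Theorems.ChaosClosesEulerReadout
  (empiricalMomentumField_apply_eq_momentumObservable stub_readoutFields stub_readoutChains exists_good_instant)

/-! ## §1 Smooth tests suffice for the momentum field -/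

/-- **It suffices to test the empirical MOMENTUM field against smooth functions.** If the empirical kinetic energy at
time `t` is tight and the momentum convergence in probability at `t` holds for every SMOOTH test `χ`, then it holds for
every continuous `χ` (approximate `χ` uniformly by a smooth `ψ`; on `{e ≤ K}` the `χ`- and `ψ`-deviations differ by
`O(‖χ − ψ‖_∞(1 + K))`). The momentum component of `tendstoHydroFieldsAt_of_isSmooth`. [folklore] -/
theorem tendsto_momentum_of_isSmooth {ε : ℕ → ℝ}
    (P : (N : ℕ) → Measure (Config (N + 1) (Fin 3) T3))
    (Φ : (N : ℕ) → HardSphereFlow (Torus.geometry (Fin 3)) (ε N) (N + 1))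
    (ρ : ℝ → T3 → ℝ) (u : ℝ → T3 → V3) (t : ℝ) (hρ : Continuous (ρ t)) (hu : Continuous (u t))
    (htight : ∀ η : ℝ, 0 < η → ∃ K : ℝ, ∃ N₀ : ℕ, ∀ N, N₀ ≤ N →
      P N {z | K < empiricalEnergyField ((Φ N).flow t z) (fun _ => 1)} ≤ ENNReal.ofReal η)
    (h : ∀ χ : T3 → ℝ, Torus.IsSmooth χ → ∀ δ : ℝ, 0 < δ →
      Tendsto (fun N => P N {z | δ < ‖empiricalMomentumField ((Φ N).flow t z) χ -
        ∫ x, (χ x * ρ t x) • u t x‖}) atTop (𝓝 0))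
    (χ : T3 → ℝ) (hχ : Continuous χ) {δ : ℝ} (hδ : 0 < δ) :
    Tendsto (fun N => P N {z | δ < ‖empiricalMomentumField ((Φ N).flow t z) χ -
      ∫ x, (χ x * ρ t x) • u t x‖}) atTop (𝓝 0) := by
  obtain ⟨Bρ, hBρ0, hBρ⟩ := exists_abs_le_of_continuous_T3 hρ
  obtain ⟨Bu, hBu0, hBu⟩ := exists_abs_le_of_continuous_T3 (continuous_norm.comp hu)
  set V : ℝ := ((volume : Measure T3) univ).toReal with hV
  have hV0 : 0 ≤ V := ENNReal.toReal_nonneg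
  refine ENNReal.tendsto_zero_of_forall_le_add fun η hη => ?_
  obtain ⟨K, N₀, hK⟩ := htight η hη
  set M : ℝ := 1 + max K 0 + Bρ * Bu * V with hM
  have hKmax : (0 : ℝ) ≤ max K 0 := le_max_right _ _
  have hBBV : 0 ≤ Bρ * Bu * V := mul_nonneg (mul_nonneg hBρ0 hBu0) hV0
  have hMpos : 0 < M := by rw [hM]; linarith
  set δ' : ℝ := δ / (2 * M) with hδ'def
  have hδ' : 0 < δ' := div_pos hδ (mul_pos two_pos hMpos)
  have hsmall : δ' * M = δ / 2 := by rw [hδ'def]; field_simp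
  obtain ⟨ψ, hψs, hψ⟩ := exists_isSmooth_near hχ hδ'
  refine ⟨fun N => P N {z | δ / 2 < ‖empiricalMomentumField ((Φ N).flow t z) ψ -
      ∫ x, (ψ x * ρ t x) • u t x‖}, h ψ hψs (δ / 2) (half_pos hδ), ?_⟩
  filter_upwards [eventually_ge_atTop N₀] with N hN
  refine le_trans (measure_mono fun z hz => ?_) ((measure_union_le _ _).trans
    (add_le_add le_rfl (hK N hN)))
  simp only [mem_setOf_eq, mem_union] at hz ⊢
  by_contra hcon
  rw [not_or, not_lt, not_lt] at hcon
  set z' := (Φ N).flow t z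
  obtain ⟨-, hm, -⟩ := empiricalFields_sub_le z' hψ
  have hψc : Continuous ψ := hψs.continuous
  have i3 : Integrable (fun x => (ψ x * ρ t x) • u t x) (volume : Measure T3) :=
    ((hψc.mul hρ).smul hu).integrable_of_hasCompactSupport (HasCompactSupport.of_compactSpace _)
  have i4 : Integrable (fun x => (χ x * ρ t x) • u t x) (volume : Measure T3) :=
    ((hχ.mul hρ).smul hu).integrable_of_hasCompactSupport (HasCompactSupport.of_compactSpace _)
  have hl : ‖(∫ x, (ψ x * ρ t x) • u t x) - ∫ x, (χ x * ρ t x) • u t x‖ ≤ δ' * (Bρ * Bu * V) := by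
    rw [← integral_sub i3 i4]
    calc _ ≤ δ' * Bρ * Bu * V := norm_integral_le_of_norm_le_const (ae_of_all _ fun x => by
            rw [← sub_smul, norm_smul, Real.norm_eq_abs, ← sub_mul, abs_mul]
            have := hBu x
            simp only [Function.comp_apply, abs_of_nonneg (norm_nonneg _)] at this
            exact mul_le_mul (mul_le_mul (hψ x) (hBρ x) (abs_nonneg _) hδ'.le) this
              (norm_nonneg _) (mul_nonneg hδ'.le hBρ0))
      _ = δ' * (Bρ * Bu * V) := by ring
  have htri : ‖empiricalMomentumField z' χ - ∫ x, (χ x * ρ t x) • u t x‖ ≤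
      ‖empiricalMomentumField z' ψ - ∫ x, (ψ x * ρ t x) • u t x‖ +
      ‖empiricalMomentumField z' ψ - empiricalMomentumField z' χ‖ +
      ‖(∫ x, (ψ x * ρ t x) • u t x) - ∫ x, (χ x * ρ t x) • u t x‖ := by
    have e : empiricalMomentumField z' χ - ∫ x, (χ x * ρ t x) • u t x =
        (empiricalMomentumField z' ψ - ∫ x, (ψ x * ρ t x) • u t x) -
        (empiricalMomentumField z' ψ - empiricalMomentumField z' χ) +
        ((∫ x, (ψ x * ρ t x) • u t x) - ∫ x, (χ x * ρ t x) • u t x) := by abel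
    rw [e]
    exact (norm_add_le _ _).trans (add_le_add (norm_sub_le _ _) le_rfl)
  have he : empiricalEnergyField z' (fun _ => 1) ≤ max K 0 := hcon.2.trans (le_max_left _ _)
  have hm' : ‖empiricalMomentumField z' ψ - empiricalMomentumField z' χ‖ ≤ δ' * (1 / 2 + max K 0) :=
    hm.trans (mul_le_mul_of_nonneg_left (by linarith) hδ'.le)
  have h1 : δ' * (1 / 2 + max K 0) + δ' * (Bρ * Bu * V) ≤ δ / 2 := by
    rw [← hsmall, ← mul_add]
    refine mul_le_mul_of_nonneg_left ?_ hδ'.le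
    rw [hM]
    linarith
  linarith [hcon.1, hz, htri, hm', hl]

/-! ## §2 The momentum chain with the speed-jump functional -/

/-- **MOMENTUM chain (speed-jump form).** Along one good orbit, with the vector tests `J_k = b • e_k` and `t ≤ s₀`:
`‖M_b(t) − ∫ b • m(t)‖ ≤ 3((s₀ − t)·L·2Ē + L·(ε/(N+1))·½𝒮(t, s₀]) + ω_b(r)(1/2 + Ē) + L·e_m(s₀) + L·e_U`, `Ē` the
kinetic energy per particle of the datum, `𝒮(t, s₀]` the windowed normal-speed-jump functional. [folklore] -/
theorem momentum_chain_speedJump {N : ℕ} {σ : ℝ} (Φ : HardSphereFlow (Torus.geometry (Fin 3)) (hsDiameter σ N) (N + 1))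
    {z : Config (N + 1) (Fin 3) T3} (hz : z ∈ Φ.good) {b : T3 → ℝ} (hbc : Continuous b) {L : ℝ} (hL0 : 0 ≤ L)
    (hbC : ∀ x, |b x| ≤ L)
    (hJ : ∀ k : Fin 3, Torus.IsContDiff 1 (fun x => b x • EuclideanSpace.single k (1 : ℝ)) ∧
      (∀ x, ‖Torus.fderiv (fun x => b x • EuclideanSpace.single k (1 : ℝ)) x‖ ≤ L))
    {r : ℝ} (hr : 0 < r) (hr2 : r ≤ 1 / 2) {ωr : ℝ} (hω0 : 0 ≤ ωr)
    (hmod : ∀ x y, Torus.euclidDist x y < r → |b x - b y| ≤ ωr) {t s₀ : ℝ} (hts : t ≤ s₀)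
    {m : ℝ → T3 → V3} (hms : Continuous (m s₀)) (hmt : Continuous (m t)) {eU : ℝ} (hU : ∀ x, ‖m s₀ x - m t x‖ ≤ eU) :
    ‖empiricalMomentumField (Φ.flow t z) b - ∫ x, b x • m t x‖ ≤
      3 * ((s₀ - t) * (L * (2 * (((N + 1 : ℕ) : ℝ)⁻¹ * configEnergy z))) +
        L * (hsDiameter σ N * ((N + 1 : ℕ) : ℝ)⁻¹ * (2⁻¹ *
          collisionalTransferFunctional (Torus.geometry (Fin 3)) (hsDiameter σ N)
            (fun i _ pre post => ‖(post i).2 - (pre i).2‖) (fun s => Φ.flow s z) t s₀))) +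
      ωr * (1 / 2 + ((N + 1 : ℕ) : ℝ)⁻¹ * configEnergy z) +
      L * (∫ x, ‖empiricalMomentumField (Φ.flow s₀ z) (fun y => cone r y x) - m s₀ x‖) + L * eU := by
  have hn : (0 : ℝ) < ((N + 1 : ℕ) : ℝ) := by positivity
  have hEs : ∀ s, configEnergy (Φ.flow s z) = configEnergy z := fun s => Φ.configEnergy_flow hz s
  set S : ℝ := collisionalTransferFunctional (Torus.geometry (Fin 3)) (hsDiameter σ N)
    (fun i _ pre post => ‖(post i).2 - (pre i).2‖) (fun s => Φ.flow s z) t s₀ with hS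
  -- m1: time modulus, component by component
  have m1 : ‖empiricalMomentumField (Φ.flow t z) b - empiricalMomentumField (Φ.flow s₀ z) b‖ ≤
      3 * ((s₀ - t) * (L * (2 * (((N + 1 : ℕ) : ℝ)⁻¹ * configEnergy z))) +
        L * (hsDiameter σ N * ((N + 1 : ℕ) : ℝ)⁻¹ * (2⁻¹ * S))) := by
    refine (stub_readoutFields _).trans ?_
    have hk : ∀ k : Fin 3, |(empiricalMomentumField (Φ.flow t z) b - empiricalMomentumField (Φ.flow s₀ z) b) k| ≤
        (s₀ - t) * (L * (2 * (((N + 1 : ℕ) : ℝ)⁻¹ * configEnergy z))) +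
        L * (hsDiameter σ N * ((N + 1 : ℕ) : ℝ)⁻¹ * (2⁻¹ * S)) := by
      intro k
      obtain ⟨hJ1, hJD⟩ := hJ k
      rw [PiLp.sub_apply, empiricalMomentumField_apply_eq_momentumObservable,
        empiricalMomentumField_apply_eq_momentumObservable, ← mul_sub, abs_mul, abs_of_nonneg (inv_nonneg.2 hn.le),
        abs_sub_comm]
      have h := abs_momentumObservable_flow_sub_le Φ hz hJ1 hJD hts
      calc ((N + 1 : ℕ) : ℝ)⁻¹ * |momentumObservable (fun x => b x • EuclideanSpace.single k (1 : ℝ)) (Φ.flow s₀ z) -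
            momentumObservable (fun x => b x • EuclideanSpace.single k (1 : ℝ)) (Φ.flow t z)|
          ≤ ((N + 1 : ℕ) : ℝ)⁻¹ * ((s₀ - t) * (L * (2 * configEnergy z)) + L * hsDiameter σ N * (2⁻¹ * S)) :=
            mul_le_mul_of_nonneg_left h (inv_nonneg.2 hn.le)
        _ = _ := by ring
    calc ∑ k, |(empiricalMomentumField (Φ.flow t z) b - empiricalMomentumField (Φ.flow s₀ z) b) k|
        ≤ ∑ _k : Fin 3, ((s₀ - t) * (L * (2 * (((N + 1 : ℕ) : ℝ)⁻¹ * configEnergy z))) +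
          L * (hsDiameter σ N * ((N + 1 : ℕ) : ℝ)⁻¹ * (2⁻¹ * S))) := Finset.sum_le_sum fun k _ => hk k
      _ = _ := by rw [Finset.sum_const, Finset.card_univ, Fintype.card_fin, nsmul_eq_mul]; norm_num
  -- m2: cone smoothing
  have m2 : ‖empiricalMomentumField (Φ.flow s₀ z) b -
      ∫ x, b x • empiricalMomentumField (Φ.flow s₀ z) (fun y => cone r y x)‖ ≤
      ωr * (1 / 2 + ((N + 1 : ℕ) : ℝ)⁻¹ * configEnergy z) := by
    refine (norm_empiricalMomentumField_sub_integral_smul_le hr hr2 hbc hmod (Φ.flow s₀ z)).trans ?_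
    refine mul_le_mul_of_nonneg_left ?_ hω0
    have h := meanSpeed_le (Φ.flow s₀ z)
    rwa [hEs s₀] at h
  -- m3: the L¹ error at s₀
  have m3 : ‖(∫ x, b x • empiricalMomentumField (Φ.flow s₀ z) (fun y => cone r y x)) - ∫ x, b x • m s₀ x‖ ≤
      L * ∫ x, ‖empiricalMomentumField (Φ.flow s₀ z) (fun y => cone r y x) - m s₀ x‖ :=
    norm_integral_smul_sub_le hbc hbC (continuous_mollMomentum r _) hms
  -- m4: Euler time continuity
  have m4 : ‖(∫ x, b x • m s₀ x) - ∫ x, b x • m t x‖ ≤ L * eU := by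
    rw [← integral_sub (integrable_of_continuous_T3 (g := fun x => b x • m s₀ x) (hbc.smul hms))
      (integrable_of_continuous_T3 (g := fun x => b x • m t x) (hbc.smul hmt))]
    refine stub_readoutChains fun x => ?_
    rw [← smul_sub, norm_smul, Real.norm_eq_abs]
    exact mul_le_mul (hbC x) (hU x) (norm_nonneg _) hL0
  calc ‖empiricalMomentumField (Φ.flow t z) b - ∫ x, b x • m t x‖
      ≤ ‖empiricalMomentumField (Φ.flow t z) b - empiricalMomentumField (Φ.flow s₀ z) b‖ +
        (‖empiricalMomentumField (Φ.flow s₀ z) b -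
          ∫ x, b x • empiricalMomentumField (Φ.flow s₀ z) (fun y => cone r y x)‖ +
        (‖(∫ x, b x • empiricalMomentumField (Φ.flow s₀ z) (fun y => cone r y x)) - ∫ x, b x • m s₀ x‖ +
        ‖(∫ x, b x • m s₀ x) - ∫ x, b x • m t x‖)) :=
        (norm_sub_le_norm_sub_add_norm_sub _ _ _).trans (add_le_add le_rfl
          ((norm_sub_le_norm_sub_add_norm_sub _ _ _).trans (add_le_add le_rfl
            (norm_sub_le_norm_sub_add_norm_sub _ _ _))))
    _ ≤ _ := by linarith [m1, m2, m3, m4]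

/-! ## §3 The pathwise step -/

/-- **Registered sub-goal `stub_momentumAtInstantPathwise` (helper of `stub_momentumAtInstant`): THE PATHWISE STEP OF
THE MOMENTUM READOUT.** Along ONE good orbit lying outside the three bad events (energy
level `K_E` at time `0`, time-averaged `L¹(dx)` error `≤ κ₁Δ` on `[t, t + Δ]`, windowed speed-jump statistic
`(ε/(N+1))·½𝒮(t, t + Δ_s] ≤ η_s` with `Δ ≤ Δ_s`), with the tolerances small in the stated product forms, the
`b`-tested empirical momentum at the instant `t` is within `5κ/8` of `∫ (bρ)(t) • u(t)`. [folklore] -/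
theorem stub_momentumAtInstantPathwise : ∀ {N : ℕ} {σ : ℝ}, 0 < σ →
    ∀ (Φ : HardSphereFlow (Torus.geometry (Fin 3)) (hsDiameter σ N) (N + 1)) {z : Config (N + 1) (Fin 3) T3},
    z ∈ Φ.good → ∀ {T : ℝ} {ρ θ : ℝ → T3 → ℝ} {u : ℝ → T3 → V3}, IsHardSphereEulerSolution σ T ρ u θ →
    ∀ {t Δ Δs : ℝ}, 0 ≤ t → 0 < Δ → t + Δ < T → Δ ≤ Δs →
    ∀ {b : T3 → ℝ}, Continuous b → ∀ {L : ℝ}, 0 < L → (∀ x, |b x| ≤ L) →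
    (∀ k : Fin 3, Torus.IsContDiff 1 (fun x => b x • EuclideanSpace.single k (1 : ℝ)) ∧
      (∀ x, ‖Torus.fderiv (fun x => b x • EuclideanSpace.single k (1 : ℝ)) x‖ ≤ L)) →
    ∀ {KE : ℝ}, ((N : ℝ) + 1)⁻¹ * configEnergy (Φ.flow 0 z) ≤ KE →
    ∀ {r : ℝ}, 0 < r → r ≤ 1 / 2 → ∀ {ωr : ℝ}, 0 < ωr → (∀ x y, Torus.euclidDist x y < r → |b x - b y| ≤ ωr) →
    ∀ {κ₁ : ℝ}, 0 < κ₁ →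
    (∫ s in Set.Icc t (t + Δ),
      ((∫ x, |empiricalDensityField (Φ.flow s z) (fun y => DensityCapNegative.cone r y x) - ρ s x|)
      + (∫ x, ‖empiricalMomentumField (Φ.flow s z) (fun y => DensityCapNegative.cone r y x) - ρ s x • u s x‖)
      + ∫ x, |empiricalEnergyField (Φ.flow s z) (fun y => DensityCapNegative.cone r y x) -
          totalEnergyDensity (ρ s x) (u s x) (θ s x)|)) ≤ κ₁ * Δ →
    ∀ {ηs : ℝ}, hsDiameter σ N * ((N : ℝ) + 1)⁻¹ * (2⁻¹ *
      collisionalTransferFunctional (Torus.geometry (Fin 3)) (hsDiameter σ N)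
        (fun i _ pre post => ‖(post i).2 - (pre i).2‖) (fun s => Φ.flow s z) t (t + Δs)) ≤ ηs →
    ∀ {eU : ℝ}, (∀ s ∈ Set.Icc t (t + Δ), ∀ x, ‖ρ s x • u s x - ρ t x • u t x‖ ≤ eU) →
    ∀ {κ : ℝ}, 6 * L * (KE + 1) * Δ ≤ κ / 8 → 3 * L * ηs ≤ κ / 8 → ωr * (KE + 1) ≤ κ / 8 →
    2 * L * κ₁ ≤ κ / 8 → L * eU ≤ κ / 8 →
    ‖empiricalMomentumField (Φ.flow t z) b - ∫ x, (b x * ρ t x) • u t x‖ ≤ 5 * κ / 8 := by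
  intro N σ hσ Φ z hz T ρ θ u hE t Δ Δs ht0 hΔ hΔT hΔs b hbc L hL0 hbC hJ KE h1 r hr hr2 ωr hωr hmod κ₁ hκ₁ h2 ηs h3
    eU hUm κ s1 s2 s3 s4 s5
  have hγ := Φ.isTrajectory z hz
  have hn : (0 : ℝ) < ((N + 1 : ℕ) : ℝ) := by positivity
  have hncast : ((N : ℝ) + 1) = ((N + 1 : ℕ) : ℝ) := by push_cast; ring
  have hEz : ((N + 1 : ℕ) : ℝ)⁻¹ * configEnergy z ≤ KE := by
    rwa [Φ.configEnergy_flow hz 0, hncast] at h1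
  have hE0 : 0 ≤ ((N + 1 : ℕ) : ℝ)⁻¹ * configEnergy z := by unfold configEnergy; positivity
  -- one good instant
  obtain ⟨s₀, hs₀, hs₀err⟩ := exists_good_instant Φ hz hr hE ht0 hΔ hΔT hκ₁ h2
  have hts : t ≤ s₀ := hs₀.1
  have hs₀Δ : s₀ ≤ t + Δ := hs₀.2
  have hs₀T : s₀ ∈ Set.Ico 0 T := ⟨ht0.trans hts, hs₀Δ.trans_lt hΔT⟩
  have htT' : t ∈ Set.Ico 0 T := ⟨ht0, by linarith⟩
  have heρ0 : 0 ≤ ∫ x, |empiricalDensityField (Φ.flow s₀ z) (fun y => cone r y x) - ρ s₀ x| :=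
    integral_nonneg fun x => abs_nonneg _
  have hee0 : 0 ≤ ∫ x, |empiricalEnergyField (Φ.flow s₀ z) (fun y => cone r y x) -
      totalEnergyDensity (ρ s₀ x) (u s₀ x) (θ s₀ x)| := integral_nonneg fun x => abs_nonneg _
  -- the speed-jump functional on `(t, s₀]` against the window `(t, t + Δs]`
  set Ss : ℝ := collisionalTransferFunctional (Torus.geometry (Fin 3)) (hsDiameter σ N)
    (fun i _ pre post => ‖(post i).2 - (pre i).2‖) (fun s => Φ.flow s z) t s₀ with hSs
  have hSs0 : 0 ≤ Ss := collisionalTransferFunctional_nonneg (fun _ _ _ _ => norm_nonneg _) _ _ _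
  have hmono : Ss ≤ collisionalTransferFunctional (Torus.geometry (Fin 3)) (hsDiameter σ N)
      (fun i _ pre post => ‖(post i).2 - (pre i).2‖) (fun s => Φ.flow s z) t (t + Δs) :=
    collisionalTransferFunctional_mono_right hγ (fun _ _ _ _ => norm_nonneg _) hts (by linarith)
  have hεn : 0 ≤ hsDiameter σ N * ((N + 1 : ℕ) : ℝ)⁻¹ := mul_nonneg (hsDiameter_pos hσ N).le (inv_nonneg.2 hn.le)
  have hWs : hsDiameter σ N * ((N + 1 : ℕ) : ℝ)⁻¹ * (2⁻¹ * Ss) ≤ ηs := by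
    rw [← hncast]
    rw [← hncast] at hεn
    exact (mul_le_mul_of_nonneg_left (mul_le_mul_of_nonneg_left hmono (by norm_num)) hεn).trans h3
  -- the Euler slices
  have hρs : Continuous (ρ s₀) := (hE.smooth_density.isSmooth_slice hs₀T).continuous
  have hρt : Continuous (ρ t) := (hE.smooth_density.isSmooth_slice htT').continuous
  have hus : Continuous (u s₀) := (hE.smooth_velocity.isSmooth_slice hs₀T).continuous
  have hut : Continuous (u t) := (hE.smooth_velocity.isSmooth_slice htT').continuous
  -- the chain
  have cm := momentum_chain_speedJump Φ hz hbc hL0.le hbC hJ hr hr2 hωr.le hmod hts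
    (m := fun s x => ρ s x • u s x) (hρs.smul hus) (hρt.smul hut) (hUm s₀ hs₀)
  -- bookkeeping of the tolerances
  have f1 : 3 * ((s₀ - t) * (L * (2 * (((N + 1 : ℕ) : ℝ)⁻¹ * configEnergy z)))) ≤ κ / 8 := by
    have h : (s₀ - t) * (L * (2 * (((N + 1 : ℕ) : ℝ)⁻¹ * configEnergy z))) ≤ Δ * (L * (2 * KE)) := by
      gcongr
      linarith only [hs₀Δ]
    have hLΔ : 0 ≤ L * Δ := by positivity
    have e : 3 * (Δ * (L * (2 * KE))) = 6 * L * (KE + 1) * Δ - 6 * (L * Δ) := by ring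
    linarith only [h, hLΔ, e, s1]
  have f2 : 3 * (L * (hsDiameter σ N * ((N + 1 : ℕ) : ℝ)⁻¹ * (2⁻¹ * Ss))) ≤ κ / 8 := by
    have h := mul_le_mul_of_nonneg_left hWs hL0.le
    linarith only [h, s2]
  have f3 : ωr * (1 / 2 + ((N + 1 : ℕ) : ℝ)⁻¹ * configEnergy z) ≤ κ / 8 :=
    (mul_le_mul_of_nonneg_left (by linarith only [hEz]) hωr.le).trans s3
  have f4 : L * (∫ x, ‖empiricalMomentumField (Φ.flow s₀ z) (fun y => cone r y x) - ρ s₀ x • u s₀ x‖) ≤ κ / 8 := by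
    have h' := mul_le_mul_of_nonneg_left
      (show (∫ x, ‖empiricalMomentumField (Φ.flow s₀ z) (fun y => cone r y x) - ρ s₀ x • u s₀ x‖) ≤ 2 * κ₁ by
        linarith only [hs₀err, heρ0, hee0]) hL0.le
    linarith only [h', s4]
  have hI : (fun x => (b x * ρ t x) • u t x) = fun x => b x • (ρ t x • u t x) := funext fun x => mul_smul _ _ _
  rw [hI]
  linarith only [cm, f1, f2, f3, f4, s5]

end Summit.AtomisticToContinuum.HydrodynamicLimit.Theorems.ParityBandClosureMomentumAtInstant

end
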